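import Literature.NumberTheory.DiophantineGeometry.CongruenceLatticeBoxCount
import HarnessLib

/-!
# The shape-solution count `B_d(c; X, Y, Z)` and its geometry-of-numbers bound

The counting function of [BernertEtAl2024, (2.3)] / [Bernert2025, §2]: for `d ≥ 1`,
`c = (c₁, c₂, c₃) ∈ ℕ³` and dyadic parameters `X, Y, Z ∈ ℕ^d`,

`B_d(c; X, Y, Z) = #{(x, y, z) ∈ ℕ^{3d} : xᵢ ~ Xᵢ, yᵢ ~ Yᵢ, zᵢ ~ Zᵢ,`
`   c₁ ∏ᵢ xᵢ^i + c₂ ∏ᵢ yᵢ^i = c₃ ∏ᵢ zᵢ^i, gcd(c₁ ∏ᵢ xᵢ, c₂ ∏ᵢ yᵢ, c₃ ∏ᵢ zᵢ) = 1}`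

(`AbcShapes.shapeCount`; tuples are `Fin d → ℕ`, the `i`-th coordinate (from `0`) carrying the
exponent `i + 1`, and `u ~ U` is the dyadic range `U ≤ u < 2U`, `AbcShapes.dyadicBox`). This is
the quantity to which `N_λ(X)` (`abcExponentCount`) is reduced in the proofs of Theorems 1.2 and
1.3 of [BernertEtAl2024] (named facts `bernertEtAl2024_thm_1_2`, `bernertEtAl2024_thm_1_3` of
`AbcExceptionalSetBounds`, NOT proved here).

## What is proved

* API: membership and cardinality of dyadic boxes, the splitting
  `∏ᵢ xᵢ^{i+1} = x₀ · ∏ᵢ x_{i+1}^{i+2}` (`shapeVal_succ`), and pairwise coprimality of the three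
  terms of a counted solution (`coprime_terms_of_mem`).
* `AbcShapes.shapeCount_succ_le` — **the geometry-of-numbers bound** [Bernert2025, Prop. 2]
  in explicit form: with the linear variables `x₀, y₀, z₀` singled out,
  `B_{d+1}(c; X, Y, Z) ≤ (∏_{i ≥ 1} Xᵢ Yᵢ Zᵢ) · (2 + 112 X₀ Y₀ / (c₃ ∏_{i ≥ 1} Zᵢ^{i+1}))`.
  Proof as printed: fix all variables but `x₀, y₀, z₀`, obtaining `a₁ x₀ + a₂ y₀ = a₃ z₀` with
  `gcd(x₀, y₀) = 1` and `gcd(a₁, a₂) = 1`; project to `(x₀, y₀)` and apply the congruence-lattice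
  box count `card_box_filter_coprime_congr_le` (`≤ 2 + 28 · (2X₀)(2Y₀)/a₃`, and
  `a₃ = c₃ ∏_{i ≥ 1} zᵢ^{i+1} ≥ c₃ ∏_{i ≥ 1} Zᵢ^{i+1}`); then sum over the `∏_{i ≥ 1} XᵢYᵢZᵢ`
  choices of the other variables. In the notation of [Bernert2025] (`Pᵢ = XᵢYᵢZᵢ`,
  `∏ Pᵢ ~ X^λ`, `c₃ ∏ Zᵢ^i ≍ X`) this is `B_d ≪ X^λ/P₁ + X^{λ-1}`.

## References

* [Bernert2025] C. Bernert, *The exceptional set in the abc conjecture*, arXiv:2506.13364 (2025),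
  §2 (definition of `B_d`) and Proposition 2.
* [BernertEtAl2024] C. Bernert, T. Browning, J. D. Lichtman, J. Teräväinen, *Bounds on the
  exceptional set in the abc conjecture*, arXiv:2410.12234, (2.3) and Proposition 3.2 (v1).
-/

noncomputable section

open Finset

namespace Literature.NumberTheory.DiophantineGeometry

namespace AbcShapes

/-! ### Shapes, dyadic boxes, and `B_d` -/

/-- The value `∏_{i < d} xᵢ^{i+1}` of a shape tuple `x : Fin d → ℕ` (the `∏_{j ≤ d} x_j^j` of the
source, indexed from `0`). [cite: BernertEtAl2024, (2.3)] -/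
def shapeVal {d : ℕ} (x : Fin d → ℕ) : ℕ :=
  ∏ i, x i ^ ((i : ℕ) + 1)

/-- The shifted value `∏_{i < d} xᵢ^{i+2}` (the cofactor of the linear variable:
`shapeVal x = x₀ · shapeTailVal (tail x)`, see `shapeVal_succ`). [folklore] -/
def shapeTailVal {d : ℕ} (x : Fin d → ℕ) : ℕ :=
  ∏ i, x i ^ ((i : ℕ) + 2)

/-- The plain product `∏ᵢ xᵢ` of a shape tuple (it carries the primes of `∏ᵢ xᵢ^{i+1}`).
[cite: BernertEtAl2024, (2.3)] -/
def shapeProd {d : ℕ} (x : Fin d → ℕ) : ℕ :=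
  ∏ i, x i

/-- The dyadic box `{x : Xᵢ ≤ xᵢ < 2Xᵢ for all i}`. [folklore] -/
def dyadicBox {d : ℕ} (X : Fin d → ℕ) : Finset (Fin d → ℕ) :=
  Fintype.piFinset fun i => Ico (X i) (2 * X i)

/-- The solutions counted by `B_d(c; X, Y, Z)`: triples of shape tuples in the dyadic boxes with
`c₁ ∏ xᵢ^{i+1} + c₂ ∏ yᵢ^{i+1} = c₃ ∏ zᵢ^{i+1}` and `gcd(c₁ ∏ xᵢ, c₂ ∏ yᵢ, c₃ ∏ zᵢ) = 1`.
[cite: BernertEtAl2024, (2.3)] -/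
def shapeTriples {d : ℕ} (c₁ c₂ c₃ : ℕ) (X Y Z : Fin d → ℕ) :
    Finset ((Fin d → ℕ) × (Fin d → ℕ) × (Fin d → ℕ)) :=
  (dyadicBox X ×ˢ dyadicBox Y ×ˢ dyadicBox Z).filter fun t =>
    c₁ * shapeVal t.1 + c₂ * shapeVal t.2.1 = c₃ * shapeVal t.2.2 ∧
      Nat.gcd (c₁ * shapeProd t.1) (Nat.gcd (c₂ * shapeProd t.2.1) (c₃ * shapeProd t.2.2)) = 1

/-- `B_d(c; X, Y, Z)`, the number of shape solutions ([BernertEtAl2024, (2.3)],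
[Bernert2025, §2]). [cite: BernertEtAl2024, (2.3)] -/
def shapeCount {d : ℕ} (c₁ c₂ c₃ : ℕ) (X Y Z : Fin d → ℕ) : ℕ :=
  (shapeTriples c₁ c₂ c₃ X Y Z).card

/-! ### API -/

/-- Membership in a dyadic box. [folklore] -/
theorem mem_dyadicBox {d : ℕ} {X x : Fin d → ℕ} :
    x ∈ dyadicBox X ↔ ∀ i, X i ≤ x i ∧ x i < 2 * X i := by
  simp [dyadicBox, Fintype.mem_piFinset, mem_Ico]

/-- A dyadic box has `∏ᵢ Xᵢ` elements. [folklore] -/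
theorem card_dyadicBox {d : ℕ} (X : Fin d → ℕ) : (dyadicBox X).card = ∏ i, X i := by
  rw [dyadicBox, Fintype.card_piFinset]
  refine prod_congr rfl fun i _ => ?_
  rw [Nat.card_Ico]
  omega

/-- Tails of box elements lie in the tail box. [folklore] -/
theorem tail_mem_dyadicBox {d : ℕ} {X x : Fin (d + 1) → ℕ} (h : x ∈ dyadicBox X) :
    Fin.tail x ∈ dyadicBox (Fin.tail X) := by
  rw [mem_dyadicBox] at h ⊢
  exact fun i => h i.succ

/-- Splitting off the linear variable: `∏_{i ≤ d} xᵢ^{i+1} = x₀ · ∏_{i < d} x_{i+1}^{i+2}`.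
[folklore] -/
theorem shapeVal_succ {d : ℕ} (x : Fin (d + 1) → ℕ) :
    shapeVal x = x 0 * shapeTailVal (Fin.tail x) := by
  rw [shapeVal, Fin.prod_univ_succ, shapeTailVal]
  simp only [Fin.val_zero, zero_add, pow_one, Fin.val_succ, Fin.tail]

/-- A prime dividing `c ∏ xᵢ^{i+1}` divides `c ∏ xᵢ`. [folklore] -/
theorem prime_dvd_mul_shapeProd {d p c : ℕ} (hp : p.Prime) {x : Fin d → ℕ}
    (h : p ∣ c * shapeVal x) : p ∣ c * shapeProd x := by
  rcases (Nat.Prime.dvd_mul hp).mp h with h1 | h1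
  · exact dvd_mul_of_dvd_left h1 _
  · rw [shapeVal] at h1
    obtain ⟨i, -, hi⟩ := (Prime.dvd_finsetProd_iff hp.prime _).mp h1
    exact dvd_mul_of_dvd_right ((hp.dvd_of_dvd_pow hi).trans
      (dvd_prod_of_mem _ (mem_univ i))) _

/-- For a counted solution the terms `c₁ ∏ xᵢ^{i+1}` and `c₂ ∏ yᵢ^{i+1}` are coprime (a common
prime would divide the third term too, hence `gcd(c₁ ∏ xᵢ, c₂ ∏ yᵢ, c₃ ∏ zᵢ) = 1`). [folklore] -/
theorem coprime_terms_of_mem {d : ℕ} {c₁ c₂ c₃ : ℕ} {X Y Z : Fin d → ℕ}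
    {t : (Fin d → ℕ) × (Fin d → ℕ) × (Fin d → ℕ)} (ht : t ∈ shapeTriples c₁ c₂ c₃ X Y Z) :
    Nat.Coprime (c₁ * shapeVal t.1) (c₂ * shapeVal t.2.1) := by
  obtain ⟨-, heq, hg⟩ := mem_filter.mp ht
  refine Nat.coprime_of_dvd fun p hp h1 h2 => ?_
  have h3 : p ∣ c₃ * shapeVal t.2.2 := by rw [← heq]; exact dvd_add h1 h2
  have h4 : p ∣ Nat.gcd (c₁ * shapeProd t.1) (Nat.gcd (c₂ * shapeProd t.2.1)
      (c₃ * shapeProd t.2.2)) :=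
    Nat.dvd_gcd (prime_dvd_mul_shapeProd hp h1)
      (Nat.dvd_gcd (prime_dvd_mul_shapeProd hp h2) (prime_dvd_mul_shapeProd hp h3))
  rw [hg] at h4
  exact hp.one_lt.ne' (Nat.dvd_one.mp h4)

/-! ### The geometry-of-numbers bound (Bernert, Proposition 2) -/

/-- **Geometry-of-numbers bound for `B_d`** [Bernert2025, Prop. 2], explicit form: for `c₃ ≥ 1`,
`B_{d+1}(c; X, Y, Z) ≤ (∏_{i ≥ 1} XᵢYᵢZᵢ) · (2 + 112 X₀Y₀ / (c₃ ∏_{i ≥ 1} Zᵢ^{i+1}))`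
(coordinates from `0`; `∏_{i ≥ 1} Zᵢ^{i+1}` is `∏_{i < d} Z_{i+1}^{i+2}`). In the source's
notation, `B_d ≪ X^λ/P₁ + X^{λ-1}`. Fix the non-linear variables, project the primitive
solutions of `a₁x₀ + a₂y₀ = a₃z₀` to `(x₀, y₀)` and use `card_box_filter_coprime_congr_le`.
[cite: Bernert2025, Proposition 2] -/
theorem shapeCount_succ_le {d : ℕ} {c₁ c₂ c₃ : ℕ} (hc₃ : 0 < c₃) (X Y Z : Fin (d + 1) → ℕ) :
    (shapeCount c₁ c₂ c₃ X Y Z : ℝ) ≤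
      (∏ i : Fin d, ((X i.succ : ℝ) * Y i.succ * Z i.succ)) *
        (2 + 112 * (X 0 : ℝ) * Y 0 / (c₃ * ∏ i : Fin d, (Z i.succ : ℝ) ^ ((i : ℕ) + 2))) := by
  classical
  set F := shapeTriples c₁ c₂ c₃ X Y Z with hF
  set O : Finset ((Fin d → ℕ) × (Fin d → ℕ) × (Fin d → ℕ)) :=
    dyadicBox (Fin.tail X) ×ˢ dyadicBox (Fin.tail Y) ×ˢ dyadicBox (Fin.tail Z) with hO
  set φ : (Fin (d + 1) → ℕ) × (Fin (d + 1) → ℕ) × (Fin (d + 1) → ℕ) →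
      (Fin d → ℕ) × (Fin d → ℕ) × (Fin d → ℕ) :=
    fun t => (Fin.tail t.1, Fin.tail t.2.1, Fin.tail t.2.2) with hφ
  have hmaps : Set.MapsTo φ (F : Set _) (O : Set _) := by
    intro t ht
    obtain ⟨hbox, -⟩ := mem_filter.mp (mem_coe.mp ht)
    simp only [mem_product] at hbox
    exact mem_coe.mpr (mem_product.mpr ⟨tail_mem_dyadicBox hbox.1,
      mem_product.mpr ⟨tail_mem_dyadicBox hbox.2.1, tail_mem_dyadicBox hbox.2.2⟩⟩)
  set B : ℝ := 2 + 112 * (X 0 : ℝ) * Y 0 / (c₃ * ∏ i : Fin d, (Z i.succ : ℝ) ^ ((i : ℕ) + 2))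
    with hB
  have hB0 : 0 ≤ B := by positivity
  /- the bound on one fibre -/
  have hfib : ∀ o ∈ O, ((F.filter (fun t => φ t = o)).card : ℝ) ≤ B := by
    rintro ⟨x', y', z'⟩ ho
    rcases (F.filter (fun t => φ t = (x', y', z'))).eq_empty_or_nonempty with he | ⟨t₀, ht₀⟩
    · rw [he, card_empty, Nat.cast_zero]; exact hB0
    simp only [hO, mem_product] at ho
    obtain ⟨-, -, hz'⟩ := ho
    set a₁ : ℕ := c₁ * shapeTailVal x' with ha₁
    set a₂ : ℕ := c₂ * shapeTailVal y' with ha₂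
    set a₃ : ℕ := c₃ * shapeTailVal z' with ha₃
    have hz'pos : ∀ i, 0 < z' i := fun i => by
      have := (mem_dyadicBox.mp hz') i; omega
    have hW : ∏ i : Fin d, Z i.succ ^ ((i : ℕ) + 2) ≤ shapeTailVal z' :=
      prod_le_prod (fun i _ => Nat.zero_le _) fun i _ =>
        Nat.pow_le_pow_left ((mem_dyadicBox.mp hz') i).1 _
    have ha₃pos : 0 < a₃ := Nat.mul_pos hc₃ (prod_pos fun i _ => pow_pos (hz'pos i) _)
    -- what membership in the fibre means
    have hmem : ∀ t ∈ F.filter (fun t => φ t = (x', y', z')),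
        (t.1 ∈ dyadicBox X ∧ t.2.1 ∈ dyadicBox Y ∧ t.2.2 ∈ dyadicBox Z) ∧
        Fin.tail t.1 = x' ∧ Fin.tail t.2.1 = y' ∧ Fin.tail t.2.2 = z' ∧
        a₁ * t.1 0 + a₂ * t.2.1 0 = a₃ * t.2.2 0 ∧
        Nat.Coprime (c₁ * shapeVal t.1) (c₂ * shapeVal t.2.1) := by
      intro t ht
      obtain ⟨htF, hφt⟩ := mem_filter.mp ht
      have hcop := coprime_terms_of_mem htF
      obtain ⟨hbox, heq, -⟩ := mem_filter.mp htF
      simp only [hφ, Prod.mk.injEq] at hφt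
      obtain ⟨h1, h2, h3⟩ := hφt
      refine ⟨by simpa only [mem_product] using hbox, h1, h2, h3, ?_, hcop⟩
      rw [shapeVal_succ, shapeVal_succ, shapeVal_succ, h1, h2, h3] at heq
      rw [ha₁, ha₂, ha₃]
      calc c₁ * shapeTailVal x' * t.1 0 + c₂ * shapeTailVal y' * t.2.1 0
          = c₁ * (t.1 0 * shapeTailVal x') + c₂ * (t.2.1 0 * shapeTailVal y') := by ring
        _ = c₃ * (t.2.2 0 * shapeTailVal z') := heq
        _ = c₃ * shapeTailVal z' * t.2.2 0 := by ring
    -- `gcd(a₁, a₂) = 1`, read off from any member `t₀`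
    obtain ⟨-, h01, h02, -, -, hcop0⟩ := hmem t₀ ht₀
    have ha₁₂ : Nat.Coprime a₁ a₂ := by
      have hd1 : a₁ ∣ c₁ * shapeVal t₀.1 := by
        rw [shapeVal_succ, h01]; exact ⟨t₀.1 0, by rw [ha₁]; ring⟩
      have hd2 : a₂ ∣ c₂ * shapeVal t₀.2.1 := by
        rw [shapeVal_succ, h02]; exact ⟨t₀.2.1 0, by rw [ha₂]; ring⟩
      exact (hcop0.coprime_dvd_left hd1).coprime_dvd_right hd2
    have hv : Nat.Coprime (Int.gcd (a₁ : ℤ) (a₂ : ℤ)) a₃ := by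
      rw [Int.gcd_natCast_natCast, ha₁₂]
      exact Nat.coprime_one_left _
    have hlat := card_box_filter_coprime_congr_le ha₃pos hv (2 * X 0) (2 * Y 0)
    refine le_trans ?_ (hlat.trans ?_)
    · -- the fibre injects into the congruence-lattice box by `t ↦ (x₀, y₀)`
      have hinj : (F.filter (fun t => φ t = (x', y', z'))).card ≤
          ((Icc (-((2 * X 0 : ℕ) : ℤ)) ((2 * X 0 : ℕ) : ℤ) ×ˢ
            Icc (-((2 * Y 0 : ℕ) : ℤ)) ((2 * Y 0 : ℕ) : ℤ)).filter
            (fun w => Int.gcd w.1 w.2 = 1 ∧ (a₃ : ℤ) ∣ (a₁ : ℤ) * w.1 + (a₂ : ℤ) * w.2)).card := by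
        refine card_le_card_of_injOn (fun t => ((t.1 0 : ℤ), (t.2.1 0 : ℤ)))
          (fun t ht => ?_) (fun t ht t' ht' h => ?_)
        · obtain ⟨⟨hbx, hby, -⟩, h1, h2, -, heq, hcop⟩ := hmem t (mem_coe.mp ht)
          have hx0 := (mem_dyadicBox.mp hbx) 0
          have hy0 := (mem_dyadicBox.mp hby) 0
          have hcxy : Nat.Coprime (t.1 0) (t.2.1 0) := by
            have hd1 : t.1 0 ∣ c₁ * shapeVal t.1 := by
              rw [shapeVal_succ]; exact ⟨c₁ * shapeTailVal (Fin.tail t.1), by ring⟩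
            have hd2 : t.2.1 0 ∣ c₂ * shapeVal t.2.1 := by
              rw [shapeVal_succ]; exact ⟨c₂ * shapeTailVal (Fin.tail t.2.1), by ring⟩
            exact (hcop.coprime_dvd_left hd1).coprime_dvd_right hd2
          dsimp only
          rw [mem_coe, mem_filter, mem_product, mem_Icc, mem_Icc]
          refine ⟨⟨⟨by omega, by omega⟩, by omega, by omega⟩, ?_, ⟨(t.2.2 0 : ℤ), ?_⟩⟩
          · rw [Int.gcd_natCast_natCast]; exact hcxy
          · dsimp only
            exact_mod_cast heq
        · obtain ⟨-, h1, h2, h3, heq, -⟩ := hmem t (mem_coe.mp ht)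
          obtain ⟨-, h1', h2', h3', heq', -⟩ := hmem t' (mem_coe.mp ht')
          simp only [Prod.mk.injEq, Nat.cast_inj] at h
          obtain ⟨hx, hy⟩ := h
          have hz : t.2.2 0 = t'.2.2 0 := by
            apply Nat.eq_of_mul_eq_mul_left ha₃pos
            rw [← heq, ← heq', hx, hy]
          refine Prod.ext ?_ (Prod.ext ?_ ?_)
          · rw [← Fin.cons_self_tail t.1, ← Fin.cons_self_tail t'.1, hx, h1, h1']
          · rw [← Fin.cons_self_tail t.2.1, ← Fin.cons_self_tail t'.2.1, hy, h2, h2']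
          · rw [← Fin.cons_self_tail t.2.2, ← Fin.cons_self_tail t'.2.2, hz, h3, h3']
      exact_mod_cast hinj
    · -- `2 + 28 (2X₀)(2Y₀)/a₃ ≤ B`
      rw [hB]
      have hden : (0 : ℝ) < c₃ * ∏ i : Fin d, (Z i.succ : ℝ) ^ ((i : ℕ) + 2) := by
        have h1 : ∀ i : Fin d, 0 < Z i.succ := fun i => by
          have := (mem_dyadicBox.mp hz') i
          simp only [Fin.tail] at this
          omega
        have hc : (0 : ℝ) < c₃ := by exact_mod_cast hc₃
        exact mul_pos hc (prod_pos fun i _ => pow_pos (by exact_mod_cast h1 i) _)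
      have ha₃ge : (c₃ : ℝ) * ∏ i : Fin d, (Z i.succ : ℝ) ^ ((i : ℕ) + 2) ≤ (a₃ : ℝ) := by
        rw [ha₃]
        push_cast
        gcongr
        exact_mod_cast hW
      have h28 : 28 * ((2 * X 0 : ℕ) : ℝ) * ((2 * Y 0 : ℕ) : ℝ) / (a₃ : ℝ) ≤
          112 * (X 0 : ℝ) * Y 0 / (c₃ * ∏ i : Fin d, (Z i.succ : ℝ) ^ ((i : ℕ) + 2)) := by
        rw [show 28 * ((2 * X 0 : ℕ) : ℝ) * ((2 * Y 0 : ℕ) : ℝ) = 112 * (X 0 : ℝ) * Y 0 by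
          push_cast; ring]
        exact div_le_div_of_nonneg_left (by positivity) hden ha₃ge
      linarith
  /- summing over the fibres -/
  calc (shapeCount c₁ c₂ c₃ X Y Z : ℝ) = (F.card : ℝ) := rfl
    _ = ∑ o ∈ O, ((F.filter (fun t => φ t = o)).card : ℝ) := by
        rw [card_eq_sum_card_fiberwise hmaps]; push_cast; rfl
    _ ≤ ∑ o ∈ O, B := sum_le_sum hfib
    _ = O.card * B := by rw [sum_const, nsmul_eq_mul]
    _ = (∏ i : Fin d, ((X i.succ : ℝ) * Y i.succ * Z i.succ)) * B := by
        rw [hO, card_product, card_product, card_dyadicBox, card_dyadicBox, card_dyadicBox]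
        push_cast
        simp only [Fin.tail, prod_mul_distrib]
        ring

end AbcShapes

end Literature.NumberTheory.DiophantineGeometry
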